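import Literature.MathematicalPhysics.QuantumFieldTheory.Balaban1983to89.B9Eq3105FamThreeLocCDiffEntry
import Literature.MathematicalPhysics.QuantumFieldTheory.Balaban1983to89.B9Eq3105FamThreeLocDiffGRight

/-!
# `Balaban1983to89.B9Eq3105FamThreeAtLocCfgOfTails` — FAMILY 3 OF (3.105) AT THE RECORD WITH BOTH LOCATED `G′`-DIFFERENCE ENTRIES AND THE LOCATED `C`-DIFFERENCE
# WORD SUPPLIED: the record `B9Eq3105FamThreeLocDiffGOfEBlock.hasMajorant_sum_famThree_at_locCfg_chiL` (p33 g103, `hDL` discharged) with `hDR □ ν := p38's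
# B9Eq3105FamThreeLocDiffGRight.hasMajorant_hDR_at` (F3-E3, modulo the member-carrier kernel `hGK □`) and `hP3 □ := B9Eq3105FamThreeLocCDiffEntry.hasMajorant_hP3_of_tails`
# (F3-B3 FILE 6, modulo the displayed cube tails ∕ outer entries at `V′_□`) — the `hrest` family-3 summand at the located projection letters, now modulo ONLY
# member-carrier majorants of cube-side words at `V′_□ = Ṽ_□^{u⁻¹}` whose suppliers are the cube data at `Ṽ_□` through (3.33) rotations and p38's sandwich transfers
# (sub-row G-B9-LETTERS, GAPS G-B9-p33-01 ∕ G-B9-05 family 3: D1-right and D2 PLUGGED; programme FAMTHREE; lead g35 LAYER WORD FAMTHREE-4b «E3→record plug rides with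
# your next record touch»)

statement-level skeleton of published theorems with citation tags; proofs where landed; nothing here is a claim about the Yang–Mills mass gap

THE PRINTED LOCUS (held `paper:balaban1985-cmp99-background-propagators`, journal page = PDF page + 388).  (3.105) p. 414; p. 415 l. 26–37 («Next we replace the operators
G′_{□₀} and C_{□₀} by G′_□, C_□, terms with the differences G′_{□₀} − G′_□ and C_{□₀} − C_□ are small by the same reason as before»); p. 412 l. 1–9 + l. 22–36; (3.95)
p. 411; (3.100) p. 413; (3.42) p. 397; (3.48)–(3.49) pp. 398–399; Cor. 3.6 p. 408; (3.87)–(3.89) p. 409.  [2] = `Balaban1983RegularityDecay` (1.11)–(1.12) (statement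
type only); [4] = `Balaban1984PropagatorsII` (2.51)–(2.61) pp. 232–234, (2.83)–(2.85) pp. 237–238.

WHAT THIS FILE CERTIFIES (kernel-checked; 0 `def`, 0 `def … : Prop`, 0 sorry)

* ★★★ `hasMajorant_sum_famThree_at_locCfg_of_tails` — the record's conclusion (family-3 sum over the cover cubes at the located projection letters, kernel
  `3·5^{d+1}·(…)·e^{−ρ′δd}`) with its two remaining located-letter inputs SUPPLIED: `hDR □ ν` by F3-E3 (displayed instead: E3's transfers `hT13`, `hTst`, (2.61) `h2613`,
  budgets, `hGK □`, and `ε_R ≥` E3's constant, `δ_R ≤ ρ₃δ₀₃`) and `hP3 □` by F3-B3 FILE 6 (displayed instead: the units `hX`, `hXc □`, the words' budgets ∕ transfers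
  `hST4w` … `hST1w`, (2.61) `h261w`, the located left entries `hLw □ μ`, right entries `hRop □ ν`, tails `hTail0∕1∕2 □ ν`, `hSbL □`, `hGw □ ν`, the cube projection
  `hPb □`, and `ε₃ ≥ (d + 1)·ε_{P3}`, `ρ ≤ r₀ − 5ε_w − a_sep,w`).  One-line proof: the record applied to the two suppliers, each folded to the record's kernels by
  monotonicity.

HONEST SCOPE ∕ NOT CLAIMED.  Bookkeeping over landed modules; NO new inequality of [B9]; the family-3 bound is supplied MODULO the displayed member-carrier majorants of
cube-side words at `V′_□` (`hGK`, `hLw`, `hRop`, `hTail*`, `hSbL`, `hGw`, `hPb`), the cube datum `hR`, the letters' blocks `hE` ∕ `hEO` ∕ `hCinv`, units, budgets — all with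
named suppliers; NOT a node discharge; nothing continuum ∕ OS ∕ mass-gap ∕ Clay; YM mass gap NOT proved (Track A conditional rung).  No `sorry`, no `axiom`, no `… : Prop`
fact, no `instance`, no `notation`, no `def`.  NEW file; nothing landed is modified.  Cell `lit-balaban`, seat `lit-balaban-p33` gen 104, 2026-08-29;
`--supports stmt-QuantumFields-19200` as helper.  Net new unproved facts: 0.

RELATED IN THE TREE, NOT DUPLICATED (searched 2026-08-29: `rg 'at_locCfg_of_tails' Literature/` = ∅): the record `B9Eq3105FamThreeLocDiffGOfEBlock` (p33 g103), p38
`B9Eq3105FamThreeLocDiffGRight` (F3-E3), F3-B3 FILES 2–6 (`…LocCDiffSplit`, `…Atoms`, `…Chains`, `…WordsAt`, `…Entry`) — all USED BY NAME.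
-/

noncomputable section

namespace Literature.MathematicalPhysics.QuantumFieldTheory.Balaban1983to89.B9Eq3105FamThreeAtLocCfgOfTails

open NormedSpace Complex
open B6RandomWalk (HasMajorant hasMajorant_mono Ineq261 c1_nonneg)
open B9Thm34Ext (toB6)
open B9Thm37Sum (mulOp mulOp_apply)
open B9FromB6 (EBlock)
open B9Ineq347 (ScaleTransfer)
open B9Eq352DivFormLetters (conj)
open B9Eq352GradLetters (diffLetter)
open B9Eq39Adjoint (fluct)
open B9Eq360DeltaPrimeAY (AfldY)
open B9Eq360DeltaPrimeACubeY (blkCubeY)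
open B6KLevelCensusIndexV1 (KIdx kGeo)
open B6Cover236MultiLevelBlocks (cubes)
open B6GlobalChartV1 (PV boxEquiv blkV1)
open B6Geom246MultiLevelBox (blkOf)
open B6Ineq2142KLevelV1 (β)
open B9GeoNormsKLevelV1 (geo9K)
open B9GeoLemma21KLevelV1 (geo9K_len_pos)
open B9CubeGeometryInputs (geoCK)
open B9CubeLettersOpsL0 (deltaPrimeACubeY GpCubeY)
open B9CubeLettersBondOpsL0 (QpCubeY QpsCubeY XCubeY XinvCubeY)
open B9CubeLettersInvReadings (kernelFamilySInv kernelFamilyBInv)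
open B9Thm37CubeCoverCommutators (cutMulY hTY)
open B4PartitionUnity22 (thetaProf D1 D1_nonneg contDiff_thetaProf hasCompactSupport_thetaProf)
open B9Cor36CutoffField337 (bumpY)
open B9Cor36CubeCutoffs (SC NearC chiY ctrR locCfgY)
open B9Eq3105FamTwoCore (geo9K_axioms)
open B9Eq3104CutoffCommutators (hBdY DPDsY)
open B9Eq3105ZetaY (zetaY)
open B9Cor36GCubeLocLetter (locProjBY)
open B9Eq3105FamThreeLocDiffGOfEBlock (hasMajorant_sum_famThree_at_locCfg_chiL)
open B9Eq3105FamThreeLocDiffGRight (hasMajorant_hDR_at)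
open B9Eq3105FamThreeLocCDiffEntry (hasMajorant_hP3_of_tails)
open Node00 (SiteY BlkY IBondY FBondY CfgY GaugeY BondOpY BondParY toKT shiftY UboxY GpY deltaPrimeAY gaugeY parSymY etaS QpY QpsY XY XinvY gradY divY)

variable {d ℓ : ℕ} {hd : 1 ≤ d + 1} {hL : Odd (ℓ + 1) ∧ 1 < ℓ + 1} {b₀ b₁ : ℝ}
variable {𝔸 : Type} [NormedRing 𝔸] [NormedAlgebra ℂ 𝔸] [CompleteSpace 𝔸]
variable {ι : Type} [Fintype ι]
variable (i : KIdx d ℓ hd hL b₀ b₁) (b : Module.Basis ι ℝ 𝔸)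

section Record

variable [Fintype (geo9K i).Site] [DecidableEq (geo9K i).Site] {Rr : ℝ} {H : Prop} {Rr' : ℝ} {Hp : Prop}
variable {B : B9.Backgrounds} (cfg : B.Cfg → CfgY 𝔸 i) (par : BondParY 𝔸 i) {U₁ : B.Cfg}

open Classical in
set_option maxHeartbeats 12800000 in
/-- ★★★ **FAMILY 3 AT THE LOCATED PROJECTION LETTERS WITH `hDL`, `hDR` AND `hP3` SUPPLIED** (the record with F3-E3 and F3-B3 FILE 6 plugged in; see the module
docstring for what remains displayed). [cite: Balaban1985BackgroundPropagators, (3.105) p.414, p.415 l.26–37, p.412 l.1–9 + l.22–36, (3.95) p.411, (3.100) p.413, Cor. 3.6 p.408, (3.42) p.397, (3.48)–(3.49) pp.398–399, (3.87)–(3.89) p.409; Balaban1983RegularityDecay, (1.11)–(1.12) (statement type); Balaban1984PropagatorsII, Lemma 2.1 (2.60)–(2.61) p.234, (2.83)–(2.85) pp.237–238] -/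
theorem hasMajorant_sum_famThree_at_locCfg_of_tails
    {BG δG : ℝ} (hE : EBlock (kernelFamilySInv i B cfg (fun W => GpY i (parSymY i) W) (parSymY i)) BG δG U₁) (hBG : 0 ≤ BG) (hδG0 : 0 ≤ δG)
    (Oc : ↥(cubes i.D.toDomains) → BondOpY 𝔸 i) {B₀ δ : ℝ} (hB₀ : 0 ≤ B₀) (hδ : 0 < δ)
    (hEO : ∀ c : ↥(cubes i.D.toDomains), EBlock (kernelFamilyBInv i B cfg (Oc c) par) B₀ δ U₁)
    (ιB : BlkY i → IBondY i) (hι : ∀ s, β i.hN i.D i.hk (ιB s) = s)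
    (hpar : ∀ z w : SiteY i, ‖(parSymY i (cfg U₁) z w : 𝔸)‖ ≤ 1 ∧ ‖(((parSymY i (cfg U₁) z w)⁻¹ : 𝔸ˣ) : 𝔸)‖ ≤ 1)
    {M₂ : ℝ} (hM₂ : 0 ≤ M₂) (hrepr : ∀ (v : 𝔸) (j : ι), |b.repr v j| ≤ M₂ * ‖v‖) (hη : etaS i = |i.cf|⁻¹)
    {s B₁ δX : ℝ} (hs : (etaS i ^ 2 * etaS i ^ 2) * s = 1) (hB₁ : 0 ≤ B₁)
    (hCinv : HasMajorant (g := toB6 (geo9K i) Rr' Hp) (fun q : BlkY i × ι => ιB q.1) (conj b (s • (XinvY i (parSymY i) (fun W => GpY i (parSymY i) W) (cfg U₁)).restrictScalars ℝ))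
      (fun a a' => B₁ * ((geo9K i).len a ^ 4)⁻¹ * Real.exp (-(δX * (geo9K i).dist a a'))))
    (u : ↥(cubes i.D.toDomains) → GaugeY 𝔸 i) (hu : ∀ (c : ↥(cubes i.D.toDomains)) (x), ‖((u c x : 𝔸ˣ) : 𝔸)‖ ≤ 1 ∧ ‖(((u c x)⁻¹ : 𝔸ˣ) : 𝔸)‖ ≤ 1)
    (A : ↥(cubes i.D.toDomains) → AfldY 𝔸 i)
    (Q : ↥(cubes i.D.toDomains) → Set (Site (PV d ℓ i.m i.K hd hL) 0)) (η : ℝ)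
    (hQ : ∀ (c : ↥(cubes i.D.toDomains)) (x : Site (PV d ℓ i.m i.K hd hL) 0), NearC i c (35 * SC i c / 8 + 1) (boxEquiv i.hN x).1 → x ∈ Q c)
    (hgA : ∀ (c : ↥(cubes i.D.toDomains)) (κ : Fin (d + 1)) (x : Site (PV d ℓ i.m i.K hd hL) 0), x ∈ Q c → x.shift κ ∈ Q c →
      gaugeY i (u c) (cfg U₁) κ x = fluct η (A c) κ x)
    (hU : IsUnit (deltaPrimeAY i (parSymY i) (cfg U₁)))
    (hV : ∀ c : ↥(cubes i.D.toDomains), IsUnit (deltaPrimeACubeY i c (parSymY i) (gaugeY i (u c)⁻¹ (locCfgY i c η (A c)))))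
    (dBc dBE : ℕ) {θ δc αc asep ρE bb : ℝ} (hθ : 0 ≤ θ) (hδc : 0 ≤ δc) (hαc1 : αc ≤ 1) (hasep : 0 ≤ asep) (hρE : 0 ≤ ρE) (hsplitE : asep + ρE ≤ 1)
    (hrate : bb * δG ≤ (1 - αc) * δc) (h261c : ∀ c : ↥(cubes i.D.toDomains), Ineq261 dBc (toB6 (geoCK i c) Rr H) δc αc)
    (h261E : Ineq261 dBE (toB6 (geo9K i) Rr' Hp) δG (bb - ρE))
    (hR : ∀ c : ↥(cubes i.D.toDomains), HasMajorant (g := toB6 (geoCK i c) Rr H) (fun p : SiteY i × ι => blkCubeY i c p.1)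
      (conj b (((cutMulY (𝔸 := 𝔸) (chiY i c) * deltaPrimeACubeY i c (parSymY i) (locCfgY i c η (A c)) -
          deltaPrimeACubeY i c (parSymY i) (locCfgY i c η (A c)) * cutMulY (𝔸 := 𝔸) (chiY i c)) * GpCubeY i c (parSymY i) (locCfgY i c η (A c))).restrictScalars ℝ))
      (fun a s' => θ * Real.exp (-(δc * (geoCK i c).dist a s'))))
    {εT δT εR δR : ℝ}
    (hεDT : (M₂ * (∑ j, ‖b j‖) * BG * (1 + D1 thetaProf / 3)) *
          (Real.exp (-(asep * δG * (3 / 8 * (i.Mh : ℝ) - 1))) +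
            ((M₂ * ∑ j, ‖b j‖) ^ 2 * (θ * B6.c1 dBc δc αc)) * B6.c1 dBE δG (bb - ρE) * Real.exp (-(asep * δG * (3 / 8 * (i.Mh : ℝ) - 2)))) ≤ εT)
    (hδDT : δT ≤ ρE * δG) (hεR : εR ≤ εT) (hδR : δT ≤ δR)
    -- F3-E3 (p38 `hasMajorant_hDR_at`): its transfers, budgets and the member-carrier kernel `hGK` of `G′_□(V′)·[Δ′_□(V′), M_{χ_□}]`
    (dB3 : ℕ) {δ₀3 aG α3 Λ3 θK bK αst3 Λst asep3 ρ3 : ℝ} (hδ₀3 : 0 ≤ δ₀3) (haG : aG * δ₀3 ≤ δG) (hα3 : 0 ≤ α3) (hΛ3 : 0 ≤ Λ3)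
    (hT13 : ScaleTransfer (geo9K i) δ₀3 α3 Λ3 (fun a => (geo9K i).len a)) (hθK : 0 ≤ θK) (hΛst : 0 ≤ Λst)
    (hTst : ScaleTransfer (geo9K i) δ₀3 αst3 Λst (fun a => (geo9K i).len a)) (hasep3 : 0 ≤ asep3) (hρ3 : 0 ≤ ρ3) (hsplitL : αst3 + ρ3 ≤ bK)
    (hsplit3 : α3 + asep3 + ρ3 ≤ aG) (h2613 : Ineq261 dB3 (toB6 (geo9K i) Rr' Hp) δ₀3 (aG - α3 - asep3 - ρ3))
    (hGK : ∀ c : ↥(cubes i.D.toDomains), HasMajorant (g := toB6 (geo9K i) Rr' Hp) (fun p : SiteY i × ι => ιB (blkOf i.D.toDomains p.1))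
      (conj b (((GpCubeY i c (parSymY i) (gaugeY i (u c)⁻¹ (locCfgY i c η (A c))) *
          (deltaPrimeACubeY i c (parSymY i) (gaugeY i (u c)⁻¹ (locCfgY i c η (A c))) * cutMulY (𝔸 := 𝔸) (chiY i c) -
            cutMulY (𝔸 := 𝔸) (chiY i c) * deltaPrimeACubeY i c (parSymY i) (gaugeY i (u c)⁻¹ (locCfgY i c η (A c))))).restrictScalars ℝ :
        Module.End ℝ (SiteY i → 𝔸))))
      (fun (a y'' : (geo9K i).Site) => θK * Real.exp (-(bK * δ₀3 * (geo9K i).dist a y''))))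
    (hεR3 : (M₂ * (∑ j, ‖b j‖) * BG * (1 + Λ3 * (D1 thetaProf / 3)) *
        (Real.exp (-(asep3 * δ₀3 * (3 / 8 * (i.Mh : ℝ) - 1))) + θK * Λst * B6.c1 dB3 δ₀3 (aG - α3 - asep3 - ρ3) * Real.exp (-(asep3 * δ₀3 * (3 / 8 * (i.Mh : ℝ) - 3))))) ≤ εR)
    (hδR' : δR ≤ ρ3 * δ₀3)
    -- F3-B3 (this lane, FILE 6 `hasMajorant_hP3_of_tails`): the four units, budgets, and the displayed cube tails ∕ outer entries at `V′_□`
    (hX : IsUnit (XY i (parSymY i) (fun W => GpY i (parSymY i) W) (cfg U₁)))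
    (hXc : ∀ c : ↥(cubes i.D.toDomains), IsUnit (XCubeY i c (parSymY i) (gaugeY i (u c)⁻¹ (locCfgY i c η (A c)))))
    (dBw : ℕ) {κL κPb κT0 κT1 κT2 κSb κR κG r₀ rT0 rT1 rT2 rSb rR rG δ₀w αw βw asepw CS CA CT3 CT1 C1 : ℝ}
    (hκL : 0 ≤ κL) (hκPb : 0 ≤ κPb) (hκT0 : 0 ≤ κT0) (hκT1 : 0 ≤ κT1) (hκT2 : 0 ≤ κT2) (hκSb : 0 ≤ κSb) (hκR : 0 ≤ κR) (hκG : 0 ≤ κG)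
    (hCS : 0 ≤ CS) (hCA : 0 ≤ CA) (hCT3 : 0 ≤ CT3) (hCT1 : 0 ≤ CT1) (hC1 : 0 ≤ C1)
    (hαδw : 0 ≤ αw * δ₀w) (hε0w : 0 ≤ (αw + βw) * δ₀w) (hasepw : 0 ≤ asepw) (hρw0 : 0 ≤ r₀ - 5 * ((αw + βw) * δ₀w) - asepw)
    (hrSw : r₀ - (αw + βw) * δ₀w ≤ δX) (hrAw : r₀ - 2 * ((αw + βw) * δ₀w) ≤ δG) (hrcw : r₀ - 3 * ((αw + βw) * δ₀w) - asepw ≤ bb * δG)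
    (hrT0 : r₀ - 4 * ((αw + βw) * δ₀w) - asepw ≤ rT0) (hrT1 : r₀ - 4 * ((αw + βw) * δ₀w) - asepw ≤ rT1) (hrT2 : r₀ - 2 * ((αw + βw) * δ₀w) - asepw ≤ rT2)
    (hrSb : r₀ - (αw + βw) * δ₀w ≤ rSb) (hrR : r₀ - 2 * ((αw + βw) * δ₀w) - asepw ≤ rR) (hrG : r₀ - 5 * ((αw + βw) * δ₀w) - asepw ≤ rG)
    (hST4w : ScaleTransfer (geo9K i) δ₀w αw CS (fun a => ((geo9K i).len a ^ 4)⁻¹)) (hST2w : ScaleTransfer (geo9K i) δ₀w αw CA (fun a => (geo9K i).len a ^ 2))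
    (hST3w : ScaleTransfer (geo9K i) δ₀w αw CT3 (fun a => ((geo9K i).len a ^ 3)⁻¹)) (hSTm1w : ScaleTransfer (geo9K i) δ₀w αw CT1 (fun a => ((geo9K i).len a)⁻¹))
    (hST1w : ScaleTransfer (geo9K i) δ₀w αw C1 (fun a => (geo9K i).len a)) (h261w : Ineq261 dBw (toB6 (geo9K i) Rr' Hp) δ₀w βw)
    (hLw : ∀ (c : ↥(cubes i.D.toDomains)) (μ : Fin (d + 1)), HasMajorant (g := toB6 (geo9K i) Rr' Hp) (fun p : SiteY i × ι => ιB (blkOf i.D.toDomains p.1))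
      (conj b (diffLetter (shiftY i) (UboxY i (cfg U₁)) (((etaS i : ℝ) : ℂ))⁻¹ (Sum.inl μ)) * mulOp (fun p : SiteY i × ι => bumpY i (ctrR i c) (3 * (SC i c : ℝ)) p.1) *
        conj b (((((etaS i ^ 2 : ℝ) : ℂ)) • GpCubeY i c (parSymY i) (gaugeY i (u c)⁻¹ (locCfgY i c η (A c)))).restrictScalars ℝ))
      (fun a a' : (geo9K i).Site => (if a ∈ (Finset.univ.filter fun a : (geo9K i).Site => ∃ z : SiteY i, ιB (blkOf i.D.toDomains z) = a ∧ NearC i c (21 * SC i c / 8 + 1) z.1)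
        then (1 : ℝ) else 0) * (κL * (geo9K i).len a * Real.exp (-(r₀ * (geo9K i).dist a a')))))
    (hRop : ∀ (c : ↥(cubes i.D.toDomains)) (ν : Fin (d + 1)), HasMajorant (g := toB6 (geo9K i) Rr' Hp) (fun p : SiteY i × ι => ιB (blkOf i.D.toDomains p.1))
      (conj b (((((etaS i ^ 2 : ℝ) : ℂ)) • GpCubeY i c (parSymY i) (gaugeY i (u c)⁻¹ (locCfgY i c η (A c)))).restrictScalars ℝ) *
        mulOp (fun p : SiteY i × ι => bumpY i (ctrR i c) (3 * (SC i c : ℝ)) p.1) * conj b (diffLetter (shiftY i) (UboxY i (cfg U₁)) (((etaS i : ℝ) : ℂ))⁻¹ (Sum.inr ν)))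
      (fun a a' => κR * (geo9K i).len a * Real.exp (-(rR * (geo9K i).dist a a'))))
    (hTail0 : ∀ (c : ↥(cubes i.D.toDomains)) (ν : Fin (d + 1)), HasMajorant (g := toB6 (geo9K i) Rr' Hp) (fun p : SiteY i × ι => ιB (blkOf i.D.toDomains p.1))
      (conj b ((((s : ℝ) : ℂ) • (QpsCubeY i c (parSymY i) (gaugeY i (u c)⁻¹ (locCfgY i c η (A c))) ∘ₗ XinvCubeY i c (parSymY i) (gaugeY i (u c)⁻¹ (locCfgY i c η (A c))) ∘ₗ
            QpCubeY i c (parSymY i) (gaugeY i (u c)⁻¹ (locCfgY i c η (A c))))).restrictScalars ℝ) *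
        mulOp (fun p : SiteY i × ι => if NearC i c (3 * SC i c) p.1.1 then (1 : ℝ) else 0) *
        (conj b (((((etaS i ^ 2 : ℝ) : ℂ)) • GpCubeY i c (parSymY i) (gaugeY i (u c)⁻¹ (locCfgY i c η (A c)))).restrictScalars ℝ) *
          mulOp (fun p : SiteY i × ι => bumpY i (ctrR i c) (3 * (SC i c : ℝ)) p.1) * conj b (diffLetter (shiftY i) (UboxY i (cfg U₁)) (((etaS i : ℝ) : ℂ))⁻¹ (Sum.inr ν))))
      (fun a a' => κT0 * ((geo9K i).len a ^ 3)⁻¹ * Real.exp (-(rT0 * (geo9K i).dist a a'))))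
    (hTail1 : ∀ (c : ↥(cubes i.D.toDomains)) (ν : Fin (d + 1)), HasMajorant (g := toB6 (geo9K i) Rr' Hp) (fun p : SiteY i × ι => ιB (blkOf i.D.toDomains p.1))
      (conj b (((((etaS i ^ 2 : ℝ) : ℂ)) • GpCubeY i c (parSymY i) (gaugeY i (u c)⁻¹ (locCfgY i c η (A c)))).restrictScalars ℝ) *
        (conj b ((((s : ℝ) : ℂ) • (QpsCubeY i c (parSymY i) (gaugeY i (u c)⁻¹ (locCfgY i c η (A c))) ∘ₗ XinvCubeY i c (parSymY i) (gaugeY i (u c)⁻¹ (locCfgY i c η (A c))) ∘ₗ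
            QpCubeY i c (parSymY i) (gaugeY i (u c)⁻¹ (locCfgY i c η (A c))))).restrictScalars ℝ) *
          mulOp (fun p : SiteY i × ι => if NearC i c (3 * SC i c) p.1.1 then (1 : ℝ) else 0) *
          (conj b (((((etaS i ^ 2 : ℝ) : ℂ)) • GpCubeY i c (parSymY i) (gaugeY i (u c)⁻¹ (locCfgY i c η (A c)))).restrictScalars ℝ) *
          mulOp (fun p : SiteY i × ι => bumpY i (ctrR i c) (3 * (SC i c : ℝ)) p.1) * conj b (diffLetter (shiftY i) (UboxY i (cfg U₁)) (((etaS i : ℝ) : ℂ))⁻¹ (Sum.inr ν)))))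
      (fun a a' => κT1 * ((geo9K i).len a)⁻¹ * Real.exp (-(rT1 * (geo9K i).dist a a'))))
    (hTail2 : ∀ (c : ↥(cubes i.D.toDomains)) (ν : Fin (d + 1)), HasMajorant (g := toB6 (geo9K i) Rr' Hp) (fun p : SiteY i × ι => ιB (blkOf i.D.toDomains p.1))
      (conj b (((((etaS i ^ 2 : ℝ) : ℂ)) • GpCubeY i c (parSymY i) (gaugeY i (u c)⁻¹ (locCfgY i c η (A c)))).restrictScalars ℝ) *
        conj b (((((etaS i ^ 2 : ℝ) : ℂ)) • GpCubeY i c (parSymY i) (gaugeY i (u c)⁻¹ (locCfgY i c η (A c)))).restrictScalars ℝ) *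
        (conj b ((((s : ℝ) : ℂ) • (QpsCubeY i c (parSymY i) (gaugeY i (u c)⁻¹ (locCfgY i c η (A c))) ∘ₗ XinvCubeY i c (parSymY i) (gaugeY i (u c)⁻¹ (locCfgY i c η (A c))) ∘ₗ
            QpCubeY i c (parSymY i) (gaugeY i (u c)⁻¹ (locCfgY i c η (A c))))).restrictScalars ℝ) *
          mulOp (fun p : SiteY i × ι => if NearC i c (3 * SC i c) p.1.1 then (1 : ℝ) else 0) *
          (conj b (((((etaS i ^ 2 : ℝ) : ℂ)) • GpCubeY i c (parSymY i) (gaugeY i (u c)⁻¹ (locCfgY i c η (A c)))).restrictScalars ℝ) *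
          mulOp (fun p : SiteY i × ι => bumpY i (ctrR i c) (3 * (SC i c : ℝ)) p.1) * conj b (diffLetter (shiftY i) (UboxY i (cfg U₁)) (((etaS i : ℝ) : ℂ))⁻¹ (Sum.inr ν)))))
      (fun a a' => κT2 * (geo9K i).len a * Real.exp (-(rT2 * (geo9K i).dist a a'))))
    (hSbL : ∀ c : ↥(cubes i.D.toDomains), HasMajorant (g := toB6 (geo9K i) Rr' Hp) (fun p : SiteY i × ι => ιB (blkOf i.D.toDomains p.1))
      (mulOp (fun p : SiteY i × ι => if NearC i c (3 * SC i c) p.1.1 then (1 : ℝ) else 0) *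
        conj b ((((s : ℝ) : ℂ) • (QpsCubeY i c (parSymY i) (gaugeY i (u c)⁻¹ (locCfgY i c η (A c))) ∘ₗ XinvCubeY i c (parSymY i) (gaugeY i (u c)⁻¹ (locCfgY i c η (A c))) ∘ₗ
            QpCubeY i c (parSymY i) (gaugeY i (u c)⁻¹ (locCfgY i c η (A c))))).restrictScalars ℝ))
      (fun a a' => κSb * ((geo9K i).len a ^ 4)⁻¹ * Real.exp (-(rSb * (geo9K i).dist a a'))))
    (hGw : ∀ (c : ↥(cubes i.D.toDomains)) (ν : Fin (d + 1)), HasMajorant (g := toB6 (geo9K i) Rr' Hp) (fun p : SiteY i × ι => ιB (blkOf i.D.toDomains p.1))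
      (conj b ((((s : ℝ) : ℂ) • (QpsCubeY i c (parSymY i) (gaugeY i (u c)⁻¹ (locCfgY i c η (A c))) ∘ₗ XinvCubeY i c (parSymY i) (gaugeY i (u c)⁻¹ (locCfgY i c η (A c))) ∘ₗ
            QpCubeY i c (parSymY i) (gaugeY i (u c)⁻¹ (locCfgY i c η (A c))))).restrictScalars ℝ) *
        (conj b (((((etaS i ^ 2 : ℝ) : ℂ)) • GpCubeY i c (parSymY i) (gaugeY i (u c)⁻¹ (locCfgY i c η (A c)))).restrictScalars ℝ) *
          mulOp (fun p : SiteY i × ι => bumpY i (ctrR i c) (3 * (SC i c : ℝ)) p.1) * conj b (diffLetter (shiftY i) (UboxY i (cfg U₁)) (((etaS i : ℝ) : ℂ))⁻¹ (Sum.inr ν))))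
      (fun a a' => κG * ((geo9K i).len a ^ 3)⁻¹ * Real.exp (-(rG * (geo9K i).dist a a'))))
    (hPb : ∀ c : ↥(cubes i.D.toDomains), HasMajorant (g := toB6 (geo9K i) Rr' Hp) (fun p : SiteY i × ι => ιB (blkOf i.D.toDomains p.1))
      (conj b ((QpsCubeY i c (parSymY i) (gaugeY i (u c)⁻¹ (locCfgY i c η (A c))) ∘ₗ QpCubeY i c (parSymY i) (gaugeY i (u c)⁻¹ (locCfgY i c η (A c)))).restrictScalars ℝ))
      (fun a a' : (geo9K i).Site => if a = a' then κPb else 0))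
    (dB : ℕ) {δ₀ δP α β' ρ Λ : ℝ} (hΛ : 1 ≤ Λ) (hρ : 0 ≤ ρ) (hα : 0 ≤ α) (hβ : 0 ≤ β') (hδ₀ : 0 ≤ δ₀)
    (hδG' : δP ≤ δG) (hδX' : δP ≤ δX) (hδD' : δP ≤ δT) (hr : ρ + (2 * α + β') * δ₀ ≤ δP)
    (h261 : Ineq261 dB (toB6 (geo9K i) Rr' Hp) δ₀ β')
    (hT1 : ScaleTransfer (geo9K i) δ₀ α Λ (fun a => (geo9K i).len a)) (hT4 : ScaleTransfer (geo9K i) δ₀ α Λ (fun a => ((geo9K i).len a ^ 4)⁻¹))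
    {ε₃ : ℝ}
    (hε₃w : ((d : ℝ) + 1) *
          (κL * ((M₂ * ∑ j, ‖b j‖) ^ 2 * B₁) * κPb * κT2 * (CS * C1) * B6.c1 dBw δ₀w βw ^ 2 * Real.exp (-(asepw * (3 / 8 * (i.Mh : ℝ) - 1))) +
            κL * ((M₂ * ∑ j, ‖b j‖) ^ 2 * B₁) * (M₂ * (∑ j, ‖b j‖) * BG) ^ 2 * (M₂ * ∑ j, ‖b j‖) ^ 2 * κT0 * (CS * CA ^ 2 * CT3) * B6.c1 dBw δ₀w βw ^ 4 *
              Real.exp (-(asepw * (3 / 8 * (i.Mh : ℝ) - 1))) +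
            κL * ((M₂ * ∑ j, ‖b j‖) ^ 2 * B₁) * (M₂ * (∑ j, ‖b j‖) * BG) ^ 2 * ((M₂ * ∑ j, ‖b j‖) ^ 2 * (θ * B6.c1 dBc δc αc)) * κT0 * (CS * CA ^ 2 * CT3) *
              B6.c1 dBw δ₀w βw ^ 5 * Real.exp (-(asepw * (3 / 8 * (i.Mh : ℝ) - 2))) +
            κL * ((M₂ * ∑ j, ‖b j‖) ^ 2 * B₁) * (M₂ * (∑ j, ‖b j‖) * BG) * ((M₂ * ∑ j, ‖b j‖) ^ 2 * (θ * B6.c1 dBc δc αc)) * κT1 * (CS * CA * CT1) *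
              B6.c1 dBw δ₀w βw ^ 4 * Real.exp (-(asepw * (3 / 8 * (i.Mh : ℝ) - 2))) +
            κL * ((M₂ * ∑ j, ‖b j‖) ^ 2 * B₁) * κR * (CS * C1) * B6.c1 dBw δ₀w βw ^ 2 * Real.exp (-(asepw * (3 / 8 * (i.Mh : ℝ) - 1))) +
            κL * κSb * κR * (CS * C1) * B6.c1 dBw δ₀w βw ^ 2 * Real.exp (-(asepw * (3 / 8 * (i.Mh : ℝ) - 1))) +
            κL * Real.exp (-(asepw * (3 / 8 * (i.Mh : ℝ) - 1))) * (((M₂ * ∑ j, ‖b j‖) ^ 2 * B₁) * κR * C1 * B6.c1 dBw δ₀w βw) * CT3 * B6.c1 dBw δ₀w βw +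
            κL * Real.exp (-(asepw * (3 / 8 * (i.Mh : ℝ) - 1))) * κG * CT3 * B6.c1 dBw δ₀w βw) ≤ ε₃)
    (hρw : ρ ≤ r₀ - 5 * ((αw + βw) * δ₀w) - asepw)
    (dB' : ℕ) {αst ρ' Λ' : ℝ} (hΛ' : 0 ≤ Λ') (hρ' : 0 ≤ ρ') (hsplit : αst + ρ' ≤ ρ / δ)
    (h261' : Ineq261 dB' (toB6 (geo9K i) Rr' Hp) δ (1 - ρ')) (hST : ScaleTransfer (geo9K i) δ αst Λ' (fun a => (geo9K i).len a ^ 2)) :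
    HasMajorant (g := toB6 (geo9K i) Rr' Hp) (fun p : FBondY i × ι => ιB (blkV1 i.hN i.D p.1))
      (∑ c : ↥(cubes i.D.toDomains), conj b ((cutMulY (𝔸 := 𝔸) (hBdY i (zetaY i c)) *
        (DPDsY i (parSymY i) (fun W => GpY i (parSymY i) W) (cfg U₁) - locProjBY i c (parSymY i) (u c) (locCfgY i c η (A c))) *
        (cutMulY (𝔸 := 𝔸) (hBdY i (hTY i c)) * Oc c (cfg U₁) * cutMulY (𝔸 := 𝔸) (hBdY i (hTY i c)))).restrictScalars ℝ))
      (fun a b' => (3 * 5 ^ (d + 1)) *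
        ((((M₂ * ∑ j, ‖b j‖) * (M₂ * ∑ j, ‖b j‖) * B₁ * Λ ^ 4 * B6.c1 dB δ₀ β' ^ 2 *
              (((d : ℝ) + 1) * εT * (2 * (M₂ * (∑ j, ‖b j‖) * BG) + εT)) + ε₃) *
            (M₂ * (∑ j, ‖b j‖) * B₀) * Λ' * B6.c1 dB' δ (1 - ρ')) * Real.exp (-(ρ' * δ * (geo9K i).dist a b')))) := by
  obtain ⟨-, -, hdnn⟩ := geo9K_axioms i Rr' Hp
  have hSum : 0 ≤ M₂ * ∑ j, ‖b j‖ := mul_nonneg hM₂ (Finset.sum_nonneg fun j _ => norm_nonneg _)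
  have hc13 : 0 ≤ B6.c1 dB3 δ₀3 (aG - α3 - asep3 - ρ3) := c1_nonneg _ _ _
  have hc1w : 0 ≤ B6.c1 dBw δ₀w βw := c1_nonneg _ _ _
  have hc1c : 0 ≤ B6.c1 dBc δc αc := c1_nonneg _ _ _
  have hD1 : 0 ≤ D1 thetaProf := D1_nonneg contDiff_thetaProf hasCompactSupport_thetaProf
  -- E3's constant is nonnegative, hence so is `ε_R`
  have hεR0 : 0 ≤ εR := le_trans (by positivity) hεR3
  -- F3-E3: the right-located `G′`-difference entries, folded to `ε_R·ℓ(a)·e^{−δ_Rd}`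
  have hDR : ∀ (c : ↥(cubes i.D.toDomains)) (ν : Fin (d + 1)), HasMajorant (g := toB6 (geo9K i) Rr' Hp) (fun p : SiteY i × ι => ιB (blkOf i.D.toDomains p.1))
      (conj b ((etaS i ^ 2) • ((GpY i (parSymY i) (cfg U₁) - GpCubeY i c (parSymY i) (gaugeY i (u c)⁻¹ (locCfgY i c η (A c)))) ∘ₗ
          cutMulY (𝔸 := 𝔸) (bumpY i (ctrR i c) (3 * (SC i c : ℝ)))).restrictScalars ℝ) *
        conj b (diffLetter (shiftY i) (UboxY i (cfg U₁)) (((etaS i : ℝ) : ℂ))⁻¹ (Sum.inr ν)))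
      (fun a a' => εR * (geo9K i).len a * Real.exp (-(δR * (geo9K i).dist a a'))) := fun c ν => by
    refine hasMajorant_mono (g := toB6 (geo9K i) Rr' Hp) _
      (hasMajorant_hDR_at i c b cfg hE hBG ιB hι hM₂ hrepr hη ν (u c) η (A c) (hQ c) (hgA c) hU (hV c) dB3 hδ₀3 haG hα3 hΛ3 hT13 hθK hΛst hTst hasep3 hρ3
        hsplitL hsplit3 h2613 (hGK c)) fun a a' => ?_
    have hl := (geo9K_len_pos i a).le
    refine mul_le_mul (mul_le_mul_of_nonneg_right hεR3 hl) (Real.exp_le_exp.2 (neg_le_neg (mul_le_mul_of_nonneg_right hδR' (hdnn a a')))) (Real.exp_nonneg _)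
      (mul_nonneg hεR0 hl)
  -- F3-B3 FILE 6: the located `C`-difference word, folded to `ε₃·ℓ(a)⁻²·e^{−ρd}`
  have hε₃0 : 0 ≤ ε₃ := le_trans (by positivity) hε₃w
  have hP3 : ∀ c : ↥(cubes i.D.toDomains), HasMajorant (g := toB6 (geo9K i) Rr' Hp) (fun p : FBondY i × ι => ιB (blkV1 i.hN i.D p.1))
      (conj b ((gradY i (cfg U₁) ∘ₗ (cutMulY (𝔸 := 𝔸) (bumpY i (ctrR i c) (3 * (SC i c : ℝ))) ∘ₗ
        (GpCubeY i c (parSymY i) (gaugeY i (u c)⁻¹ (locCfgY i c η (A c))) ∘ₗ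
          ((QpsY i (parSymY i) (cfg U₁) ∘ₗ XinvY i (parSymY i) (fun W => GpY i (parSymY i) W) (cfg U₁) ∘ₗ QpY i (parSymY i) (cfg U₁))
            - (QpsCubeY i c (parSymY i) (gaugeY i (u c)⁻¹ (locCfgY i c η (A c))) ∘ₗ
                XinvCubeY i c (parSymY i) (gaugeY i (u c)⁻¹ (locCfgY i c η (A c))) ∘ₗ
                QpCubeY i c (parSymY i) (gaugeY i (u c)⁻¹ (locCfgY i c η (A c))))) ∘ₗ
          GpCubeY i c (parSymY i) (gaugeY i (u c)⁻¹ (locCfgY i c η (A c)))) ∘ₗ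
        cutMulY (𝔸 := 𝔸) (bumpY i (ctrR i c) (3 * (SC i c : ℝ)))) ∘ₗ divY i (cfg U₁)).restrictScalars ℝ))
      (fun a y => ε₃ * ((geo9K i).len a ^ 2)⁻¹ * Real.exp (-(ρ * (geo9K i).dist a y))) := fun c => by
    refine hasMajorant_mono (g := toB6 (geo9K i) Rr' Hp) _
      (hasMajorant_hP3_of_tails i c b cfg hE hBG ιB hι hpar hM₂ hrepr hη hs hB₁ hCinv (u c) (hu c) (A c) (Q c) η (hQ c) (hgA c) hX (hXc c) hU (hV c) dBc
        hθ hδc hαc1 hrate (h261c c) (hR c) dBw hκL hκPb hκT0 hκT1 hκT2 hκSb hκR hκG hCS hCA hCT3 hCT1 hC1 hαδw hε0w hasepw hρw0 hrSw hrAw hrcw hrT0 hrT1 hrT2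
        hrSb hrR hrG hST4w hST2w hST3w hSTm1w hST1w h261w (hLw c) (hRop c) (hTail0 c) (hTail1 c) (hTail2 c) (hSbL c) (hGw c) (hPb c)) fun a y => ?_
    have hl : 0 ≤ ((geo9K i).len a ^ 2)⁻¹ := by have := (geo9K_len_pos i a).le; positivity
    refine mul_le_mul (mul_le_mul_of_nonneg_right hε₃w hl) (Real.exp_le_exp.2 (neg_le_neg (mul_le_mul_of_nonneg_right hρw (hdnn a y)))) (Real.exp_nonneg _)
      (mul_nonneg hε₃0 hl)
  exact hasMajorant_sum_famThree_at_locCfg_chiL i b cfg par hE hBG hδG0 Oc hB₀ hδ hEO ιB hι hpar hM₂ hrepr hη hs hB₁ hCinv u hu A Q η hQ hgA hU hV dBc dBE hθ hδc hαc1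
    hasep hρE hsplitE hrate h261c h261E hR hεDT hδDT hεR hδR hDR dB hΛ hρ hα hβ hδ₀ hδG' hδX' hδD' hr h261 hT1 hT4 hε₃0 hP3 dB' hΛ' hρ'
    hsplit h261' hST

end Record

end Literature.MathematicalPhysics.QuantumFieldTheory.Balaban1983to89.B9Eq3105FamThreeAtLocCfgOfTails
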